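import Mathlib

/-!
# BC5 rung for crux `SqrtDomination` (route `SquareRootCeilings`, item stmt-QuantumFields-26670) — the Gaussian cycle bound

For sums-of-squares composites `Pᵢ = |φ⁽ⁱ⁾|²` of a centred Gaussian multiplet the joint cumulant is
`κ(P₁;…;Pₙ) = 2ⁿ⁻¹ Σ_cycles tr ∏ₑ Dₑ` over the cross-covariance blocks `D i j`, and `Cov(Pᵢ,Pⱼ) = 2‖D i j‖_F²`.
The rung proved here is the block-matrix inequality that makes every cycle pay ONE square root of a covariance bound per
visited point:

  `|tr (D_{p₀p₁} D_{p₁p₂} ⋯ D_{p_{m−1}p₀})| ≤ ∏ₖ √(b (p k))`   whenever `‖D i j‖_F² ≤ b i` for `i ≠ j` and `m ≥ 2`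

(trace Cauchy–Schwarz `|tr(XY)| ≤ ‖X‖_F‖Y‖_F` + Frobenius submultiplicativity along the cycle). It is the free-field
(β = ∞) shadow of the lever K2 and sits outside the leaf's known regime (nothing about the interacting leaf is decided by
it); it is exactly the structure K2 bets survives the crossover. Statement = the registered stub `stub_gaussianCycleRung`
of `Cruxes/SqrtDomination/Lines/birth.lean` (evidence on stmt-QuantumFields-26670), now WITHOUT sorry.
-/

set_option autoImplicit false

namespace Summit.QuantumFields.YangMills.Cruxes.SqrtDomination.Rung

open Finset

section Frobenius

variable {ι : Type} [Fintype ι]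

/-- Frobenius norm squared of a real square matrix. -/
def fro (X : Matrix ι ι ℝ) : ℝ := ∑ a, ∑ c, (X a c) ^ 2

/-- `0 ≤ ‖X‖_F²`. -/
theorem fro_nonneg (X : Matrix ι ι ℝ) : 0 ≤ fro X := by
  unfold fro; positivity

/-- an iterated sum over `ι` twice is a sum over `ι × ι`. -/
theorem sum_sum_eq_sum_prod (F : ι → ι → ℝ) : ∑ a, ∑ c, F a c = ∑ x : ι × ι, F x.1 x.2 := by
  rw [Fintype.sum_prod_type]

/-- trace Cauchy–Schwarz: `|tr (X Y)| ≤ ‖X‖_F ‖Y‖_F`. -/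
theorem abs_trace_mul_le (X Y : Matrix ι ι ℝ) :
    |Matrix.trace (X * Y)| ≤ Real.sqrt (fro X) * Real.sqrt (fro Y) := by
  have htr : Matrix.trace (X * Y) = ∑ x : ι × ι, X x.1 x.2 * Y x.2 x.1 := by
    rw [← sum_sum_eq_sum_prod (fun a c => X a c * Y c a)]
    simp [Matrix.trace, Matrix.mul_apply]
  have hX : fro X = ∑ x : ι × ι, (X x.1 x.2) ^ 2 := sum_sum_eq_sum_prod (fun a c => (X a c) ^ 2)
  have hY : fro Y = ∑ x : ι × ι, (Y x.2 x.1) ^ 2 := by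
    rw [← sum_sum_eq_sum_prod (fun a c => (Y c a) ^ 2)]
    unfold fro
    exact Finset.sum_comm
  rw [htr, hX, hY]
  calc |∑ x : ι × ι, X x.1 x.2 * Y x.2 x.1|
      ≤ ∑ x : ι × ι, |X x.1 x.2| * |Y x.2 x.1| := by
        refine (Finset.abs_sum_le_sum_abs _ _).trans (le_of_eq ?_)
        exact Finset.sum_congr rfl fun x _ => abs_mul _ _
    _ ≤ Real.sqrt (∑ x : ι × ι, |X x.1 x.2| ^ 2) * Real.sqrt (∑ x : ι × ι, |Y x.2 x.1| ^ 2) :=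
        Real.sum_mul_le_sqrt_mul_sqrt _ _ _
    _ = Real.sqrt (∑ x : ι × ι, (X x.1 x.2) ^ 2) * Real.sqrt (∑ x : ι × ι, (Y x.2 x.1) ^ 2) := by
        simp only [sq_abs]

/-- Frobenius submultiplicativity `‖X Y‖_F² ≤ ‖X‖_F² ‖Y‖_F²`. -/
theorem fro_mul_le (X Y : Matrix ι ι ℝ) : fro (X * Y) ≤ fro X * fro Y := by
  unfold fro
  calc ∑ a, ∑ c, ((X * Y) a c) ^ 2
      ≤ ∑ a, ∑ c, (∑ l, (X a l) ^ 2) * (∑ l, (Y l c) ^ 2) := by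
        refine Finset.sum_le_sum fun a _ => Finset.sum_le_sum fun c _ => ?_
        rw [Matrix.mul_apply]
        exact Finset.sum_mul_sq_le_sq_mul_sq _ _ _
    _ = (∑ a, ∑ l, (X a l) ^ 2) * (∑ c, ∑ l, (Y l c) ^ 2) := by
        rw [Finset.sum_mul_sum]
    _ = (∑ a, ∑ l, (X a l) ^ 2) * (∑ l, ∑ c, (Y l c) ^ 2) := by
        congr 1
        exact Finset.sum_comm

/-- Frobenius submultiplicativity along a nonempty list: `‖N·∏l‖_F² ≤ ‖N‖_F² ∏ ‖·‖_F²`. -/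
theorem fro_prod_le [DecidableEq ι] : ∀ (N : Matrix ι ι ℝ) (l : List (Matrix ι ι ℝ)),
    fro ((N :: l).prod) ≤ ((N :: l).map fro).prod
  | N, [] => by simp
  | N, (M :: l) => by
      rw [List.prod_cons, List.map_cons, List.prod_cons]
      calc fro (N * (M :: l).prod) ≤ fro N * fro ((M :: l).prod) := fro_mul_le _ _
        _ ≤ fro N * ((M :: l).map fro).prod :=
            mul_le_mul_of_nonneg_left (fro_prod_le M l) (fro_nonneg N)

/-- `√(∏ ‖·‖_F²) = ∏ ‖·‖_F` along a list. -/
theorem sqrt_prod_map_fro (l : List (Matrix ι ι ℝ)) :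
    Real.sqrt ((l.map fro).prod) = (l.map fun N => Real.sqrt (fro N)).prod := by
  induction l with
  | nil => simp
  | cons N l ih => rw [List.map_cons, List.prod_cons, List.map_cons, List.prod_cons,
      Real.sqrt_mul (fro_nonneg N), ih]

/-- the cycle bound: a trace of a product of at least two blocks pays one Frobenius norm per block. -/
theorem abs_trace_cons_cons_prod_le [DecidableEq ι] (M N : Matrix ι ι ℝ) (l : List (Matrix ι ι ℝ)) :
    |Matrix.trace ((M :: N :: l).prod)| ≤ ((M :: N :: l).map fun X => Real.sqrt (fro X)).prod := by
  rw [List.prod_cons, List.map_cons, List.prod_cons]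
  calc |Matrix.trace (M * (N :: l).prod)|
      ≤ Real.sqrt (fro M) * Real.sqrt (fro ((N :: l).prod)) := abs_trace_mul_le _ _
    _ ≤ Real.sqrt (fro M) * Real.sqrt (((N :: l).map fro).prod) :=
        mul_le_mul_of_nonneg_left (Real.sqrt_le_sqrt (fro_prod_le N l)) (Real.sqrt_nonneg _)
    _ = Real.sqrt (fro M) * ((N :: l).map fun X => Real.sqrt (fro X)).prod := by
        rw [sqrt_prod_map_fro]

end Frobenius

/-- **BC5 rung (Gaussian cycle bound)** — verbatim the statement of `stub_gaussianCycleRung`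
(`Cruxes/SqrtDomination/Lines/birth.lean`), proved. -/
theorem gaussianCycleRung : ∀ (ι : Type) [Fintype ι] [DecidableEq ι] (n m : ℕ), 2 ≤ m →
    ∀ (D : Fin n → Fin n → Matrix ι ι ℝ) (b : Fin n → ℝ), (∀ i, 0 ≤ b i) →
    (∀ i j, i ≠ j → ∑ a, ∑ c, (D i j a c) ^ 2 ≤ b i) →
    ∀ p : Fin m → Fin n, (∀ k : Fin m, p k ≠ p (finRotate m k)) →
    |Matrix.trace ((List.ofFn (fun k : Fin m => D (p k) (p (finRotate m k)))).prod)| ≤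
      ∏ k : Fin m, Real.sqrt (b (p k)) := by
  intro ι _ _ n m hm D b _hb hD p hp
  obtain ⟨m', rfl⟩ : ∃ m', m = m' + 2 := ⟨m - 2, by omega⟩
  set g : Fin (m' + 2) → Matrix ι ι ℝ := fun k => D (p k) (p (finRotate (m' + 2) k)) with hg
  have hfro : ∀ k, fro (g k) ≤ b (p k) := fun k => hD _ _ (hp k)
  have step1 : |Matrix.trace ((List.ofFn g).prod)| ≤
      ((List.ofFn g).map fun X => Real.sqrt (fro X)).prod := by
    rw [List.ofFn_succ, List.ofFn_succ]
    exact abs_trace_cons_cons_prod_le _ _ _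
  have step2 : ((List.ofFn g).map fun X => Real.sqrt (fro X)).prod = ∏ k, Real.sqrt (fro (g k)) := by
    rw [List.map_ofFn, List.prod_ofFn]
    rfl
  calc |Matrix.trace ((List.ofFn g).prod)|
      ≤ ((List.ofFn g).map fun X => Real.sqrt (fro X)).prod := step1
    _ = ∏ k, Real.sqrt (fro (g k)) := step2
    _ ≤ ∏ k, Real.sqrt (b (p k)) :=
        Finset.prod_le_prod (fun k _ => Real.sqrt_nonneg _) fun k _ => Real.sqrt_le_sqrt (hfro k)

end Summit.QuantumFields.YangMills.Cruxes.SqrtDomination.Rung
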